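/-
Copyright (c) 2026 the pub-hodgecm-mathlib formalisation cell (harness21).  Prover seat hodgecm-mathlib-K2Liu-p26 (g2): Track B «K2-LIT»,
#184♮ = hLiu418 = stmt-HodgeConjecture-24832; #42F′ FACE-G, organ F4 (G-gen), road (E) (RULING M-158r∕M-158u; F4 lead K2Liu-p27 (g2): F4 LEAD ANSWER
23:25:24Z «(E-d-P) = (P-adelic) `K2LiuSWSectionRightLegInvariance` → K2Liu-p26 + (P-arch)»), brick (E-d-P)(P-adelic): THE RIGHT LEG `1 ⊗ k′` OF THE
DOUBLED TENSOR DATUM LIES IN THE SIEGEL LEVI AND COMMUTES WITH `h ⊗ 1` — hence the Siegel–Weil section of an `M₂`-space is `U(V′)(𝔸)`-SEMI-INVARIANT.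
-/
import Literature.NumberTheory.K2Lit.SiegelWeilSectionTensor                                    -- ★ `swSectionTensor`, `tensorEmb`, `epsD`, `isSiegelDeltaSection_swSection`
import Summits.HodgeConjecture.HodgeConjecture.Theorems.K2LiuSiegelWeilSectionKFinite             -- ★ `swSection_mul_right`
import HarnessLib

/-!
# Crux `HLiu418`, organ F4 (G-gen), road (E), brick (E-d-P)(P-adelic): the right-leg embedding `tensorEmbRight : U(V′)(𝔸) → U(𝔻 ⊗ V′)(𝔸)`, `k′ ↦ 1 ⊗ k′`,
# its Siegel-parabolic bookkeeping, and THE SEE-SAW PIVOT «`f^{V′}_{ω(1 ⊗ k′)Φ} = χ′_{s}(1 ⊗ k′) · f^{V′}_Φ`» (`Theorems/K2LiuSWSectionRightLegInvariance.lean`)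

Cell `hodgecm-mathlib`, crux item hLiu418 = `stmt-HodgeConjecture-24832`, route of record `HCCMUnconditional`; squad K2 ∕ K2Liu, road `K2_Liu`, socket #42F′,
FACE-G ∕ organ F4 (G-gen); F4 lead K2Liu-p27 (g2); desks K2Liu-p10 (g6), K2E5-r02 (g6).  ONE DEFINITION (`tensorEmbRight`, the twin of ★ `tensorEmb`) +
theorems (no `instance`, no `notation`, no named-fact hypothesis, no `sorry`); lane `--kind definition --supports stmt-HodgeConjecture-24832` (count-neutral helper).

WHY (road (E) STEP 3, the PIVOT; F4 lead 23:25:24Z).  ★ (E-f) `K2LiuLocalThetaCyclicUniform` is closed modulo (RED), and ★ (E-d-R) `K2LiuLocalThetaReduction.hRED_of_pivot`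
pays (RED) modulo ONE letter `hpiv : SWσ (κOp (1,k′) v) = vacScalar (1,k′) • SWσ v` — the see-saw hinge «the Siegel–Weil section functional is
`K_H`-semi-invariant».  In Folland's junction coordinates this is NOT a pointwise fact (`μ₀` of a non-real unitary is a fractional Fourier transform); it is
an ADELIC STRUCTURE FACT of the doubled tensor datum `𝔻 ⊗ V′` (★ `K2Lit.DoubledTensorEmbedding`): the right leg `1 ⊗ k′` (`k′ ∈ U(V′)(𝔸)`) PRESERVES the
diagonal `Δ ⊗ V′`, i.e. lies in the big Siegel parabolic — indeed in its Levi, block-diagonally `diag(1_n ⊗ k′, 1_n ⊗ k′)` — AND COMMUTES with `tensorEmb h = h ⊗ 1`.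
Hence, for the Siegel–Weil section `f^{V′}_Φ(h) = f_Φ(h ⊗ 1)` of the `M₂`-space (★ `swSectionTensor`) and a `χ`-normalised doubled Weil representation `sB` of
the BIG datum: `f^{V′}_{ω(sB(1⊗k′))Φ}(h) = f_Φ((h ⊗ 1)(1 ⊗ k′)) = f_Φ((1 ⊗ k′)(h ⊗ 1)) = χ′_{(1−n′)/2}(1 ⊗ k′) · f^{V′}_Φ(h)` (★ `swSection_mul_right`, ★
`isSiegelDeltaSection_swSection`) — for EVERY `k′ ∈ U(V′)(𝔸)`, compact or not.  (P-arch) (K2Liu-p11∕p05) then pins `ω(sB(tensorEmbRight (k′_σ, 1, …)))` on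
`E(𝒥_σ⁻¹(v ⊠ rest) ⊗ f)` to `κOp R S e (1, k′_σ) v` and reads the character at a compact archimedean element as `vacScalar e (1, k′_σ)`, giving `hpiv`.
THIS FILE:
* §1 **`tensorEmbRight : U(diag dV′)(𝔸) →* U(𝔻 ⊗ V′)(𝔸)`**, `k′ ↦ reindex epsD (1 ⊗ₖ k′)` (★ `adelicInr` + ★ `reindexU` + cast, the twin of ★ `tensorEmb`),
  `coe_tensorEmbRight`, `coe_tensorEmbRight_GL`, `continuous_tensorEmbRight`, **`tensorEmb_mul_tensorEmbRight`** (`(h ⊗ 1)(1 ⊗ k′) = (1 ⊗ k′)(h ⊗ 1)`,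
  ★ `commute_adelicInl_adelicInr`);
* §2 the blocks of `1 ⊗ k′` in the `Fin n′ ⊕ Fin n′` enumeration: `blk₁₁ = blk₂₂ = reindex epsV (1_n ⊗ₖ k′)`, `blk₁₂ = blk₂₁ = 0`, hence
  **`isSiegelDelta_tensorEmbRight`** (`1 ⊗ k′ ∈ P_{Δ⊗V′}(𝔸)`), `deltaBlock_tensorEmbRight`, **`detDelta_tensorEmbRight`** (`det_{Δ′}(1 ⊗ k′) = (det k′)^n`);
* §3 HEAD **`swSectionTensor_omega_tensorEmbRight`**: `swSectionTensor … sB (ω(sB (tensorEmbRight k′)) Φ) h = siegelDeltaCharacter_{big} χ ((1 − n′)/2) (tensorEmbRight k′)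
  * swSectionTensor … sB Φ h`, and the right-translation reading **`swSectionTensor_tensorEmbRight_mul`**-free corollary `swSection_tensorEmbRight_mul`:
  `f_Φ((1 ⊗ k′) · g) = χ′(1 ⊗ k′) · f_Φ(g)` on the big group.
References: [Kudla1994] S. Kudla, Israel J. Math. 87 (1994) §2 (doubled space, Siegel parabolic), §3 Thm. 3.1; [HarrisKudlaSweet1996] §1 (1.8)–(1.16);
[KudlaRallis1994] §1, §3 (see-saw); [Howe1989] §3; [GelbartRogawski1991] §3.2 p. 457 (the dual-pair maps `a`, `b`).
HONEST LABEL.  Count-neutral helper; it retires nothing by itself: `HC_CM` is proved only modulo the 7 printed citations (2 remaining named inputs: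
hLiu418 = `stmt-HodgeConjecture-24832`, h413 = `stmt-HodgeConjecture-24833`) until rung 0 closes.

## Tree search
★ `K2Lit.DoubledTensorEmbedding` (`tensorEmb`, `coe_tensorEmb`, `epsD_symm_inl∕inr`, `blk_tensorEmb_toBlocks_ij`, `isSiegelDelta_tensorEmb`, `detDelta_tensorEmb`,
`adelicForm_hermD_tensor`); ★ `Automorphic.UnitaryGroupDualPairCarriers` (`adelicInr`, `coe_adelicInr`, `commute_adelicInl_adelicInr`, `continuous_adelicInr`);
★ `Automorphic.UnitaryGroupDirectSum.reindexU`∕`reindexGL`; ★ `K2Lit.SiegelWeilSectionTensor` (`swSectionTensor_apply`); ★ `K2Lit.SiegelWeilSectionLine.isSiegelDeltaSection_swSection`;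
★ `K2LiuSiegelWeilSectionKFinite.swSection_mul_right`; ★ `K2LiuSiegelWeilTensorGenerator.swSectionTensor_mul_right` (right translation by `tensorEmb k`, the LEFT leg).
Dedup `rg "tensorEmbRight|adelicInr" Summits/…/Theorems Literature/NumberTheory/K2Lit` = ∅ (no right-leg embedding typed; memo §0 NOTE confirmed).
-/

set_option autoImplicit false
set_option linter.dupNamespace false -- the mandated namespace repeats `HodgeConjecture.HodgeConjecture`
-- the doubled metaplectic carriers elaborate slowly (cf. ★ `SiegelWeilSectionTensor`, ★ `K2LiuSiegelWeilTensorGenerator`): sequential elaboration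
set_option Elab.async false

noncomputable section

open NumberField IsDedekindDomain
open scoped Matrix Kronecker

namespace Summit.HodgeConjecture.HodgeConjecture.Cruxes.HLiu418.K2LiuSWSectionRightLegInvariance

open Literature.NumberTheory.Automorphic Literature.NumberTheory.Automorphic.UnitaryGroup Literature.NumberTheory.GaloisRepresentations
open Literature.NumberTheory.GelbartRogawski1991 Literature.NumberTheory.GelbartRogawski1991.GRConstruction
open Literature.NumberTheory.Weil1964
open Literature.NumberTheory.K2Lit.SiegelDoubled
open Summit.HodgeConjecture.HodgeConjecture.Cruxes.HLiu418.K2LiuSiegelWeilSectionKFinite (swSection_mul_right)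

variable (L : Type) [Field L] [NumberField L] [IsCMField L]
variable {N M n : ℕ} (e : Fin N × Fin M ≃ Fin n)
  (dV : Fin N → L) (hdV : ∀ i, IsCMField.complexConj L (dV i) = dV i)
  (dW : Fin M → L) (hdW : ∀ i, IsCMField.complexConj L (dW i) = dW i)
variable {M₂ M' n' : ℕ} (eW : Fin M × Fin M₂ ≃ Fin M') (e' : Fin N × Fin M' ≃ Fin n')
  (dV' : Fin M₂ → L) (hdV' : ∀ k, IsCMField.complexConj L (dV' k) = dV' k)

/-! ## §1 The right-leg embedding `k′ ↦ 1 ⊗ k′` -/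

/-- **`tensorEmbRight : U(V′)(𝔸) →* U(𝔻 ⊗ V′)(𝔸)`, `k′ ↦ reindex epsD (1 ⊗ₖ k′)`** — the right leg of the dual pair `(U(𝔻), U(V′))` inside the big doubled group
(★ `adelicInr`, ★ `reindexU`, cast along ★ `adelicForm_hermD_tensor`); the twin of ★ `tensorEmb` (`h ↦ h ⊗ 1`).
[cite: Kudla1994, §2 (doubled space, Siegel parabolic)] [cite: GelbartRogawski1991, §3.2 p. 457] -/
def tensorEmbRight : UnitaryGroup.adelic (Fp L) L (IsCMField.complexConj L) M₂ (Matrix.diagonal dV') →*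
    HA L e' dV hdV (tensorFrame L dW eW dV') (tensorFrame_real L dW hdW eW dV' hdV') :=
  (Subgroup.inclusion (le_of_eq (congrArg (unitaryGroupOfForm (UnitaryGroup.conjAdele (Fp L) L (IsCMField.complexConj L)))
      (adelicForm_hermD_tensor L e dV hdV dW hdW eW e' dV' hdV').symm))).comp <|
    (UnitaryGroup.reindexU _ (epsD e eW e') _).comp
      (UnitaryGroup.adelicInr (Fp L) L (IsCMField.complexConj L) (n + n) M₂ (hermD L e dV hdV dW hdW) (Matrix.diagonal dV'))

/-- the matrix of `tensorEmbRight k′` is `reindex epsD (1 ⊗ₖ k′)`. [cite: Kudla1994, §2 (doubled space, Siegel parabolic)] -/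
theorem coe_tensorEmbRight (k' : UnitaryGroup.adelic (Fp L) L (IsCMField.complexConj L) M₂ (Matrix.diagonal dV')) :
    (((tensorEmbRight L e dV hdV dW hdW eW e' dV' hdV' k' : HA L e' dV hdV (tensorFrame L dW eW dV') (tensorFrame_real L dW hdW eW dV' hdV')) :
        GL (Fin (n' + n')) (AdeleRing (𝓞 L) L)) : Matrix (Fin (n' + n')) (Fin (n' + n')) (AdeleRing (𝓞 L) L)) =
      Matrix.reindex (epsD e eW e') (epsD e eW e')
        ((1 : Matrix (Fin (n + n)) (Fin (n + n)) (AdeleRing (𝓞 L) L)) ⊗ₖ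
          (((k' : UnitaryGroup.adelic (Fp L) L (IsCMField.complexConj L) M₂ (Matrix.diagonal dV')) : GL (Fin M₂) (AdeleRing (𝓞 L) L)) :
            Matrix (Fin M₂) (Fin M₂) (AdeleRing (𝓞 L) L))) := by
  rfl

/-- `tensorEmbRight` in `GL`: `reindexGL epsD (1 ⊗ k′)`. [cite: Kudla1994, §2 (doubled space, Siegel parabolic)] -/
theorem coe_tensorEmbRight_GL (k' : UnitaryGroup.adelic (Fp L) L (IsCMField.complexConj L) M₂ (Matrix.diagonal dV')) :
    ((tensorEmbRight L e dV hdV dW hdW eW e' dV' hdV' k' : HA L e' dV hdV (tensorFrame L dW eW dV') (tensorFrame_real L dW hdW eW dV' hdV')) :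
        GL (Fin (n' + n')) (AdeleRing (𝓞 L) L)) =
      UnitaryGroup.reindexGL (epsD e eW e')
        ((UnitaryGroup.adelicInr (Fp L) L (IsCMField.complexConj L) (n + n) M₂ (hermD L e dV hdV dW hdW) (Matrix.diagonal dV') k' :
          UnitaryGroup.adelicPair (Fp L) L (IsCMField.complexConj L) (n + n) M₂ (hermD L e dV hdV dW hdW) (Matrix.diagonal dV')) :
            GL (Fin (n + n) × Fin M₂) (AdeleRing (𝓞 L) L)) := rfl

/-- `tensorEmbRight` is continuous. [cite: Kudla1994, §2 (doubled space, Siegel parabolic)] -/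
theorem continuous_tensorEmbRight : Continuous (tensorEmbRight L e dV hdV dW hdW eW e' dV' hdV') := by
  refine continuous_induced_rng.2 ?_
  rw [show ((↑) : HA L e' dV hdV (tensorFrame L dW eW dV') (tensorFrame_real L dW hdW eW dV' hdV') → GL (Fin (n' + n')) (AdeleRing (𝓞 L) L)) ∘
      ⇑(tensorEmbRight L e dV hdV dW hdW eW e' dV' hdV') = fun k' => UnitaryGroup.reindexGL (epsD e eW e')
        ((UnitaryGroup.adelicInr (Fp L) L (IsCMField.complexConj L) (n + n) M₂ (hermD L e dV hdV dW hdW) (Matrix.diagonal dV') k' :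
          UnitaryGroup.adelicPair (Fp L) L (IsCMField.complexConj L) (n + n) M₂ (hermD L e dV hdV dW hdW) (Matrix.diagonal dV')) :
            GL (Fin (n + n) × Fin M₂) (AdeleRing (𝓞 L) L)) from funext fun k' => coe_tensorEmbRight_GL L e dV hdV dW hdW eW e' dV' hdV' k']
  exact (UnitaryGroup.continuous_reindexGL _).comp (continuous_subtype_val.comp
    (UnitaryGroup.continuous_adelicInr (Fp L) L (IsCMField.complexConj L) (n + n) M₂ (hermD L e dV hdV dW hdW) (Matrix.diagonal dV')))

/-- **THE TWO LEGS COMMUTE**: `(h ⊗ 1) · (1 ⊗ k′) = (1 ⊗ k′) · (h ⊗ 1)` in `U(𝔻 ⊗ V′)(𝔸)` (★ `commute_adelicInl_adelicInr`).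
[cite: GelbartRogawski1991, §3.2 p. 457] [cite: Howe1989, §3] -/
theorem tensorEmb_mul_tensorEmbRight (h : HA L e dV hdV dW hdW) (k' : UnitaryGroup.adelic (Fp L) L (IsCMField.complexConj L) M₂ (Matrix.diagonal dV')) :
    tensorEmb L e dV hdV dW hdW eW e' dV' hdV' h * tensorEmbRight L e dV hdV dW hdW eW e' dV' hdV' k' =
      tensorEmbRight L e dV hdV dW hdW eW e' dV' hdV' k' * tensorEmb L e dV hdV dW hdW eW e' dV' hdV' h := by
  -- both legs factor through the same homomorphism `φ = inclusion ∘ reindexU epsD` out of the adelic pair group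
  let φ : UnitaryGroup.adelicPair (Fp L) L (IsCMField.complexConj L) (n + n) M₂ (hermD L e dV hdV dW hdW) (Matrix.diagonal dV') →*
      HA L e' dV hdV (tensorFrame L dW eW dV') (tensorFrame_real L dW hdW eW dV' hdV') :=
    (Subgroup.inclusion (le_of_eq (congrArg (unitaryGroupOfForm (UnitaryGroup.conjAdele (Fp L) L (IsCMField.complexConj L)))
        (adelicForm_hermD_tensor L e dV hdV dW hdW eW e' dV' hdV').symm))).comp
      (UnitaryGroup.reindexU (UnitaryGroup.conjAdele (Fp L) L (IsCMField.complexConj L)) (epsD e eW e')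
        (UnitaryGroup.adelicForm L (n + n) (hermD L e dV hdV dW hdW) ⊗ₖ UnitaryGroup.adelicForm L M₂ (Matrix.diagonal dV')))
  have h1 : tensorEmb L e dV hdV dW hdW eW e' dV' hdV' h =
      φ (UnitaryGroup.adelicInl (Fp L) L (IsCMField.complexConj L) (n + n) M₂ (hermD L e dV hdV dW hdW) (Matrix.diagonal dV') h) := rfl
  have h2 : tensorEmbRight L e dV hdV dW hdW eW e' dV' hdV' k' =
      φ (UnitaryGroup.adelicInr (Fp L) L (IsCMField.complexConj L) (n + n) M₂ (hermD L e dV hdV dW hdW) (Matrix.diagonal dV') k') := rfl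
  rw [h1, h2, ← map_mul, ← map_mul,
    (UnitaryGroup.commute_adelicInl_adelicInr (Fp L) L (IsCMField.complexConj L) (n + n) M₂ (hermD L e dV hdV dW hdW) (Matrix.diagonal dV') h k').eq]

/-! ## §2 Blocks: `1 ⊗ k′` lies in the Siegel Levi of `U(𝔻 ⊗ V′)` -/

/-- the `(1,1)` block of `1 ⊗ k′` is `reindex epsV (1_n ⊗ k′)`. [cite: Kudla1994, §2 (doubled space, Siegel parabolic)] -/
theorem blk_tensorEmbRight_toBlocks₁₁ (k' : UnitaryGroup.adelic (Fp L) L (IsCMField.complexConj L) M₂ (Matrix.diagonal dV')) :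
    (blk L e' dV hdV (tensorFrame L dW eW dV') (tensorFrame_real L dW hdW eW dV' hdV') (tensorEmbRight L e dV hdV dW hdW eW e' dV' hdV' k')).toBlocks₁₁ =
      Matrix.reindex (epsV e eW e') (epsV e eW e')
        ((1 : Matrix (Fin n) (Fin n) (AdeleRing (𝓞 L) L)) ⊗ₖ
          (((k' : UnitaryGroup.adelic (Fp L) L (IsCMField.complexConj L) M₂ (Matrix.diagonal dV')) : GL (Fin M₂) (AdeleRing (𝓞 L) L)) :
            Matrix (Fin M₂) (Fin M₂) (AdeleRing (𝓞 L) L))) := by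
  ext u v
  obtain ⟨⟨x, k⟩, rfl⟩ := (epsV e eW e').surjective u
  obtain ⟨⟨y, l⟩, rfl⟩ := (epsV e eW e').surjective v
  simp only [blk, Matrix.toBlocks₁₁, Matrix.reindex_apply, Matrix.submatrix_apply, Matrix.of_apply, Equiv.symm_symm,
    Equiv.symm_apply_apply, coe_tensorEmbRight, epsD_symm_inl, Matrix.kroneckerMap_apply, Matrix.one_apply, EmbeddingLike.apply_eq_iff_eq,
    Sum.inl.injEq]

/-- the `(1,2)` block of `1 ⊗ k′` vanishes. [cite: Kudla1994, §2 (doubled space, Siegel parabolic)] -/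
theorem blk_tensorEmbRight_toBlocks₁₂ (k' : UnitaryGroup.adelic (Fp L) L (IsCMField.complexConj L) M₂ (Matrix.diagonal dV')) :
    (blk L e' dV hdV (tensorFrame L dW eW dV') (tensorFrame_real L dW hdW eW dV' hdV') (tensorEmbRight L e dV hdV dW hdW eW e' dV' hdV' k')).toBlocks₁₂ = 0 := by
  ext u v
  obtain ⟨⟨x, k⟩, rfl⟩ := (epsV e eW e').surjective u
  obtain ⟨⟨y, l⟩, rfl⟩ := (epsV e eW e').surjective v
  simp only [blk, Matrix.toBlocks₁₂, Matrix.reindex_apply, Matrix.submatrix_apply, Matrix.of_apply, Equiv.symm_symm,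
    coe_tensorEmbRight, epsD_symm_inl, epsD_symm_inr, Matrix.kroneckerMap_apply, Matrix.one_apply, EmbeddingLike.apply_eq_iff_eq,
    reduceCtorEq, if_false, zero_mul, Matrix.zero_apply]

/-- the `(2,1)` block of `1 ⊗ k′` vanishes. [cite: Kudla1994, §2 (doubled space, Siegel parabolic)] -/
theorem blk_tensorEmbRight_toBlocks₂₁ (k' : UnitaryGroup.adelic (Fp L) L (IsCMField.complexConj L) M₂ (Matrix.diagonal dV')) :
    (blk L e' dV hdV (tensorFrame L dW eW dV') (tensorFrame_real L dW hdW eW dV' hdV') (tensorEmbRight L e dV hdV dW hdW eW e' dV' hdV' k')).toBlocks₂₁ = 0 := by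
  ext u v
  obtain ⟨⟨x, k⟩, rfl⟩ := (epsV e eW e').surjective u
  obtain ⟨⟨y, l⟩, rfl⟩ := (epsV e eW e').surjective v
  simp only [blk, Matrix.toBlocks₂₁, Matrix.reindex_apply, Matrix.submatrix_apply, Matrix.of_apply, Equiv.symm_symm,
    coe_tensorEmbRight, epsD_symm_inl, epsD_symm_inr, Matrix.kroneckerMap_apply, Matrix.one_apply, EmbeddingLike.apply_eq_iff_eq,
    reduceCtorEq, if_false, zero_mul, Matrix.zero_apply]

/-- the `(2,2)` block of `1 ⊗ k′` is `reindex epsV (1_n ⊗ k′)`. [cite: Kudla1994, §2 (doubled space, Siegel parabolic)] -/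
theorem blk_tensorEmbRight_toBlocks₂₂ (k' : UnitaryGroup.adelic (Fp L) L (IsCMField.complexConj L) M₂ (Matrix.diagonal dV')) :
    (blk L e' dV hdV (tensorFrame L dW eW dV') (tensorFrame_real L dW hdW eW dV' hdV') (tensorEmbRight L e dV hdV dW hdW eW e' dV' hdV' k')).toBlocks₂₂ =
      Matrix.reindex (epsV e eW e') (epsV e eW e')
        ((1 : Matrix (Fin n) (Fin n) (AdeleRing (𝓞 L) L)) ⊗ₖ
          (((k' : UnitaryGroup.adelic (Fp L) L (IsCMField.complexConj L) M₂ (Matrix.diagonal dV')) : GL (Fin M₂) (AdeleRing (𝓞 L) L)) :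
            Matrix (Fin M₂) (Fin M₂) (AdeleRing (𝓞 L) L))) := by
  ext u v
  obtain ⟨⟨x, k⟩, rfl⟩ := (epsV e eW e').surjective u
  obtain ⟨⟨y, l⟩, rfl⟩ := (epsV e eW e').surjective v
  simp only [blk, Matrix.toBlocks₂₂, Matrix.reindex_apply, Matrix.submatrix_apply, Matrix.of_apply, Equiv.symm_symm,
    Equiv.symm_apply_apply, coe_tensorEmbRight, epsD_symm_inr, Matrix.kroneckerMap_apply, Matrix.one_apply, EmbeddingLike.apply_eq_iff_eq,
    Sum.inr.injEq]

/-- **`1 ⊗ k′ ∈ P_{Δ ⊗ V′}(𝔸)`** — the right leg preserves the diagonal `Δ ⊗ V′` (it is block-diagonal with equal diagonal blocks, i.e. in the Siegel Levi).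
[cite: Kudla1994, §2 (doubled space, Siegel parabolic)] [cite: KudlaRallis1994, §3] -/
theorem isSiegelDelta_tensorEmbRight (k' : UnitaryGroup.adelic (Fp L) L (IsCMField.complexConj L) M₂ (Matrix.diagonal dV')) :
    IsSiegelDelta L e' dV hdV (tensorFrame L dW eW dV') (tensorFrame_real L dW hdW eW dV' hdV') (tensorEmbRight L e dV hdV dW hdW eW e' dV' hdV' k') := by
  unfold IsSiegelDelta
  rw [blk_tensorEmbRight_toBlocks₁₁, blk_tensorEmbRight_toBlocks₁₂, blk_tensorEmbRight_toBlocks₂₁, blk_tensorEmbRight_toBlocks₂₂, add_zero, zero_add]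

/-- **`Δ`-block of `1 ⊗ k′`**: `(1 ⊗ k′)|_{Δ ⊗ V′} = reindex epsV (1_n ⊗ₖ k′)`. [cite: Kudla1994, §2 (doubled space, Siegel parabolic)] -/
theorem deltaBlock_tensorEmbRight (k' : UnitaryGroup.adelic (Fp L) L (IsCMField.complexConj L) M₂ (Matrix.diagonal dV')) :
    deltaBlock L e' dV hdV (tensorFrame L dW eW dV') (tensorFrame_real L dW hdW eW dV' hdV') (tensorEmbRight L e dV hdV dW hdW eW e' dV' hdV' k') =
      Matrix.reindex (epsV e eW e') (epsV e eW e')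
        ((1 : Matrix (Fin n) (Fin n) (AdeleRing (𝓞 L) L)) ⊗ₖ
          (((k' : UnitaryGroup.adelic (Fp L) L (IsCMField.complexConj L) M₂ (Matrix.diagonal dV')) : GL (Fin M₂) (AdeleRing (𝓞 L) L)) :
            Matrix (Fin M₂) (Fin M₂) (AdeleRing (𝓞 L) L))) := by
  rw [deltaBlock, blk_tensorEmbRight_toBlocks₁₁, blk_tensorEmbRight_toBlocks₁₂, add_zero]

/-- **`det_{Δ′}(1 ⊗ k′) = (det k′)^n`**. [cite: Kudla1994, §3 Thm. 3.1] [cite: HarrisKudlaSweet1996, §1 (1.8)] -/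
theorem detDelta_tensorEmbRight (k' : UnitaryGroup.adelic (Fp L) L (IsCMField.complexConj L) M₂ (Matrix.diagonal dV')) :
    detDelta L e' dV hdV (tensorFrame L dW eW dV') (tensorFrame_real L dW hdW eW dV' hdV') (tensorEmbRight L e dV hdV dW hdW eW e' dV' hdV' k') =
      (((k' : UnitaryGroup.adelic (Fp L) L (IsCMField.complexConj L) M₂ (Matrix.diagonal dV')) : GL (Fin M₂) (AdeleRing (𝓞 L) L)) :
          Matrix (Fin M₂) (Fin M₂) (AdeleRing (𝓞 L) L)).det ^ n := by
  rw [detDelta, deltaBlock_tensorEmbRight, Matrix.det_reindex_self, Matrix.det_kronecker, Matrix.det_one, one_pow, one_mul, Fintype.card_fin]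

/-! ## §3 The see-saw pivot: the Siegel–Weil section of an `M₂`-space is `U(V′)(𝔸)`-semi-invariant -/

section Pivot

variable (hdV0 : ∀ i, dV i ≠ 0) (hdW0 : ∀ i, dW i ≠ 0) (hdV'0 : ∀ k, dV' k ≠ 0)

/-- **LEFT translation by the right leg on the BIG Siegel–Weil section**: `f_Φ((1 ⊗ k′) · g) = χ′_{(1−n′)/2}(1 ⊗ k′) · f_Φ(g)` for the `χ`-normalised doubled Weil
representation `sB` of the big datum (★ `isSiegelDeltaSection_swSection` at the Siegel element `1 ⊗ k′`). [cite: KudlaRallis1994, §1] [cite: Kudla1994, §3 Thm. 3.1] -/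
theorem swSection_tensorEmbRight_mul {χ : HeckeCharacter L}
    {sB : HA L e' dV hdV (tensorFrame L dW eW dV') (tensorFrame_real L dW hdW eW dV' hdV') →*
      MpD L e' dV hdV (tensorFrame L dW eW dV') (tensorFrame_real L dW hdW eW dV' hdV')}
    (hsB : IsDoubledWeilRep L e' dV hdV hdV0 (tensorFrame L dW eW dV') (tensorFrame_real L dW hdW eW dV' hdV')
      (tensorFrame_ne_zero L dW eW dV' hdW0 hdV'0) χ sB)
    (Φ : piSchwartzBruhat (Fp L) (Fin (n' + n'))) (k' : UnitaryGroup.adelic (Fp L) L (IsCMField.complexConj L) M₂ (Matrix.diagonal dV'))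
    (g : HA L e' dV hdV (tensorFrame L dW eW dV') (tensorFrame_real L dW hdW eW dV' hdV')) :
    swSection L e' dV hdV hdV0 (tensorFrame L dW eW dV') (tensorFrame_real L dW hdW eW dV' hdV') (tensorFrame_ne_zero L dW eW dV' hdW0 hdV'0) sB Φ
        (tensorEmbRight L e dV hdV dW hdW eW e' dV' hdV' k' * g) =
      siegelDeltaCharacter L e' dV hdV (tensorFrame L dW eW dV') (tensorFrame_real L dW hdW eW dV' hdV') χ ((1 - (n' : ℂ)) / 2)
          (tensorEmbRight L e dV hdV dW hdW eW e' dV' hdV' k') *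
        swSection L e' dV hdV hdV0 (tensorFrame L dW eW dV') (tensorFrame_real L dW hdW eW dV' hdV') (tensorFrame_ne_zero L dW eW dV' hdW0 hdV'0) sB Φ g :=
  isSiegelDeltaSection_swSection L e' dV hdV hdV0 (tensorFrame L dW eW dV') (tensorFrame_real L dW hdW eW dV' hdV')
    (tensorFrame_ne_zero L dW eW dV' hdW0 hdV'0) hsB Φ _ (isSiegelDelta_tensorEmbRight L e dV hdV dW hdW eW e' dV' hdV' k') g

/-- **THE SEE-SAW PIVOT (adelic form)**: the Siegel–Weil section of the `M₂`-space `V′` is SEMI-INVARIANT under the right leg `U(V′)(𝔸)` acting on the Schwartz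
datum through the big Weil representation — `f^{V′}_{ω(sB(1 ⊗ k′))Φ}(h) = χ′_{(1−n′)/2}(1 ⊗ k′) · f^{V′}_Φ(h)` for EVERY `k′ ∈ U(V′)(𝔸)` (right translation ★
`swSection_mul_right`, the legs commute `tensorEmb_mul_tensorEmbRight`, and `1 ⊗ k′` is a Siegel element `swSection_tensorEmbRight_mul`).  At a compact archimedean
`k′_σ` the character is the vacuum scalar ((P-arch)), which is (E-d)'s letter `hpiv`. [cite: KudlaRallis1994, §3] [cite: Howe1989, §3] [cite: Kudla1994, §3 Thm. 3.1] -/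
theorem swSectionTensor_omega_tensorEmbRight {χ : HeckeCharacter L}
    {sB : HA L e' dV hdV (tensorFrame L dW eW dV') (tensorFrame_real L dW hdW eW dV' hdV') →*
      MpD L e' dV hdV (tensorFrame L dW eW dV') (tensorFrame_real L dW hdW eW dV' hdV')}
    (hsB : IsDoubledWeilRep L e' dV hdV hdV0 (tensorFrame L dW eW dV') (tensorFrame_real L dW hdW eW dV' hdV')
      (tensorFrame_ne_zero L dW eW dV' hdW0 hdV'0) χ sB)
    (Φ : piSchwartzBruhat (Fp L) (Fin (n' + n'))) (k' : UnitaryGroup.adelic (Fp L) L (IsCMField.complexConj L) M₂ (Matrix.diagonal dV'))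
    (h : HA L e dV hdV dW hdW) :
    swSectionTensor L e dV hdV dW hdW eW e' dV' hdV' hdV0 hdW0 hdV'0 sB
        (adelicMpCont.omega (Fp L) (Fin (n' + n')) (gramDA L e' dV hdV (tensorFrame L dW eW dV') (tensorFrame_real L dW hdW eW dV' hdV'))
          (sB (tensorEmbRight L e dV hdV dW hdW eW e' dV' hdV' k')) Φ) h =
      siegelDeltaCharacter L e' dV hdV (tensorFrame L dW eW dV') (tensorFrame_real L dW hdW eW dV' hdV') χ ((1 - (n' : ℂ)) / 2)
          (tensorEmbRight L e dV hdV dW hdW eW e' dV' hdV' k') *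
        swSectionTensor L e dV hdV dW hdW eW e' dV' hdV' hdV0 hdW0 hdV'0 sB Φ h := by
  -- term-mode chain (no rewriting inside the metaplectic carriers, cf. ★ `swSectionTensor_mul_right`):
  -- `f_{ω(1⊗k′)Φ}(h ⊗ 1) = f_Φ((h ⊗ 1)(1 ⊗ k′)) = f_Φ((1 ⊗ k′)(h ⊗ 1)) = χ′(1 ⊗ k′) · f_Φ(h ⊗ 1)`
  have hm := tensorEmb_mul_tensorEmbRight L e dV hdV dW hdW eW e' dV' hdV' h k'
  exact (swSection_mul_right L e' dV hdV hdV0 _ _ _ sB Φ _ _).symm.trans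
    ((congrArg (fun x => swSection L e' dV hdV hdV0 (tensorFrame L dW eW dV') (tensorFrame_real L dW hdW eW dV' hdV')
        (tensorFrame_ne_zero L dW eW dV' hdW0 hdV'0) sB Φ x) hm).trans
      (swSection_tensorEmbRight_mul L e dV hdV dW hdW eW e' dV' hdV' hdV0 hdW0 hdV'0 hsB Φ k' _))

end Pivot

end Summit.HodgeConjecture.HodgeConjecture.Cruxes.HLiu418.K2LiuSWSectionRightLegInvariance

end
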